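import Summits.ResolutionOfSingularities.ResolutionOfSingularities.Theorems.MarkedTransferCampaignW31HasseStableOfLeibniz
import Literature.AlgebraicGeometry.Resolution.DiffIdealLeibnizSmooth
import HarnessLib

/-!
# [OURS · L1 W3.1] Hasse–Schmidt stability of the edge algebra (`U19_4_R2`) from `U19_3` and FORMAL SMOOTHNESS of the
# coordinate map `K[X] → O_{Z,ξ}`, `X ↦ z`; the slot statement modulo `Thm4_1` + that formal smoothness
# (steps (2)+(4) of the W3.1 route, seat res-L1-s31-pv-3)

Cell `res-hironaka` (run/shared/lean/pub/res-hironaka/), rung L (rescue) of LADDER-RESOLUTION, slot W3.1 «u.s.c. first»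
(positive rung, verdict-free). HOST (custody, no new route): the existing crux `Theses.MarkedTransfer.HypersurfaceOrderReduction`
stmt-ResolutionOfSingularities-16155, `--supports … --as helper`, as every W3.1 file. Sequel of
`MarkedTransferCampaignW31HasseStableOfLeibniz` (p480433: step (4) from an ABSTRACT Leibniz family). Here the Leibniz
families are SUPPLIED by the tree: `Resolution.exists_hasseSystem_of_formallySmooth_eval` (HasseSystemOfFormallySmooth.lean,
EGA IV₄ 16.11.2: truncated Hasse–Schmidt systems on algebras formally smooth over a polynomial ring, with their values on
all monomials) and `Resolution.isDiffOpLE_of_hasseSystem` (DiffOpCoordinateSpan.lean); so the only input left besides the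
typed `U19_3`/`Thm4_1` is the FORMAL SMOOTHNESS of `K[X_1,…,X_n] → O_{Z,ξ}`, `X_i ↦ z_i`, for a regular system of parameters
`z` at a closed singular point — standard for the smooth `Z` over the perfect `K` (separable residue field; tree route:
`Resolution.formallySmooth_mvPolynomial_of_basis_kaehlerDifferential` from a basis `dz_i` of `Ω[O_{Z,ξ}⁄K]`), taken as a
HYPOTHESIS here.

HONEST FRAMING. OURS-side algebra / pure logic over OUR typed carriers and the tree's libraries; NOTHING here is a statement
of H. Hironaka's manuscript *Resolution of singularities in positive characteristics* (2017-03-23, [Hironaka2017]). Typed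
candidates (`S04CharAlgebra.U19_3`, `S04CharAlgebra.Thm4_1`) enter ONLY as hypotheses. No FACT-LIST fact is consumed.
AI-produced; weaker than expert review.

## What is proved (sorry-free; axioms ⊆ {propext, Classical.choice, Quot.sound})

* `truncHasse_apply_mem_pow_sub`, `truncHasse_apply_mul_aeval_monomial_sub_mem`, `truncHasse_symbol_congr` — the order
  lowering and THE SYMBOL CONGRUENCE of res-L1-s31-pv-1's `MarkedTransferCampaignW31HasseSymbol` (p479063) for TRUNCATED
  systems of level `N ≥ |β|` (Leibniz rule and extension of the Hasse derivatives only in degrees `≤ N`).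
* `exists_truncHasse_extending_hasseDeriv` — `O` formally smooth over `K[X]` (`X ↦ z`) ⇒ for every `N` a `K`-linear family
  `Δ_β` with `Δ_0 = id`, Leibniz for `|β| ≤ N`, and `Δ_β(F(z)) = (D^{(β)}F)(z)` for `|β| ≤ N`, all `F ∈ K[X]` (from the tree's
  monomial values by `K`-linearity).
* `hasseDeriv_mem_of_isHomogeneous_of_formallySmooth`, **`hasseDeriv_mem_edgeG_of_formallySmooth`** — local: `(O, 𝔪, κ)` a local
  `K`-algebra formally smooth over `K[X]` via `X ↦ z` (`z` generating `𝔪`), `A` a graded family whose algebra `⊕ A_d X^d` is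
  Diff-closed in the shape of the typed `U19_3` ⇒ `edgeG (⊕ A_d X^d) z ⊆ κ[Z]` is stable under every Hasse–Schmidt derivation
  (route of p480433 with a truncated system of level `|β|`).
* **`U19_4_R2_of_U19_3_of_formallySmooth`** : `U19_3 p f E` + formal smoothness of the coordinate maps at the closed singular
  points ⇒ `U19_4_R2 p f E`.
* **`campaignW31UscInvOneExponentI_of_Thm4_1_of_formallySmooth`** : `(∀ K A E, Thm4_1 p A.hom E)` + the same formal smoothness
  ⇒ `CampaignW31UscInvOneExponentI p` — THE SLOT STATEMENT (u.s.c. of `ξ ↦ Inv_ξ(E)` on `Sing(E)_cl` for one standard `E`,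
  every selection of Def. 4.9 edge data), via the lane's `U19_3_of` and p479154.

## What remains for an unconditional W3.1

(a) `Thm4_1` (HIRONAKA-L lane Q-04-001; its clause (2) = Diff theorem F-20a + the `SIncl`/`Incl` bridge); (b) the formal
smoothness of `K[X] → O_{Z,ξ}` (`X ↦ z`): by `formallySmooth_mvPolynomial_of_basis_kaehlerDifferential` it is the statement that
`(dz_i)` is a BASIS of `Ω[O_{Z,ξ}⁄K]` (generation: Nakayama + separability, cf. the tree's
`formallyUnramified_mvPolynomial_of_span_eq_maximalIdeal`; independence: `rank Ω = n = dim O_{Z,ξ}`) together with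
`H¹(L_{O_{Z,ξ}/K}) = 0` (formal smoothness of the stalk over `K`).

## References (context only; nothing below is a premise)

* H. Hironaka, ms. 2017-03-23, Th. 4.1 p.17 l.20–30; §4.1 (8) p.19 l.27–32 — scope only, under adjudication. [Hironaka2017]
* A. Grothendieck, EGA IV₄ (Publ. IHÉS 32, 1967), §16.8, Thm. 16.11.2, Prop. 17.1.1. [EGAIV4]
-/

noncomputable section

set_option linter.dupNamespace false -- mandated namespace of this single-conjunct summit

open scoped Polynomial
open IsLocalRing MvPolynomial
-- `Finset.antidiagonal` alone resolves to the `Set.IsPWO` antidiagonal of `Data.Finset.MulAntidiagonal`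
open Finset.HasAntidiagonal (antidiagonal mem_antidiagonal)

namespace Summit.ResolutionOfSingularities.ResolutionOfSingularities.Theorems

open _root_.AlgebraicGeometry
open Literature.AlgebraicGeometry.Resolution
open Literature.AlgebraicGeometry.Hironaka2017
open Literature.AlgebraicGeometry.Hironaka2017.S02Preliminaries
open Literature.AlgebraicGeometry.Hironaka2017.S04CharAlgebra

universe u

namespace CampaignW31

/-! ## Truncated Leibniz families: order, symbol congruence -/

section Truncated

variable {K : Type u} [CommRing K] {O : Type u} [CommRing O] [Algebra K O] {n : ℕ}
  (Δ : (Fin n →₀ ℕ) → (O →ₗ[K] O)) (φ : MvPolynomial (Fin n) K →ₐ[K] O) (P : Ideal O) (N : ℕ)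
  (h0 : ∀ b, Δ 0 b = b)
  (hmul : ∀ β : Fin n →₀ ℕ, β.degree ≤ N → ∀ x y : O, Δ β (x * y) = ∑ q ∈ antidiagonal β, Δ q.1 x * Δ q.2 y)
  (hext : ∀ β : Fin n →₀ ℕ, β.degree ≤ N → ∀ F : MvPolynomial (Fin n) K, Δ β (φ F) = φ (hasseDeriv K β F))
  (hz : ∀ i, φ (X i) ∈ P)

include h0 hmul in
/-- A member `Δ_β`, `|β| ≤ N`, of a truncated Hasse–Schmidt system lowers `P`-adic orders by at most `|β|` (tree
`isDiffOpLE_of_hasseSystem` + `IsDiffOpLE.apply_mem_pow_sub`). [folklore] -/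
theorem truncHasse_apply_mem_pow_sub {β : Fin n →₀ ℕ} (hβ : β.degree ≤ N) (j : ℕ) {x : O} (hx : x ∈ P ^ j) :
    Δ β x ∈ P ^ (j - β.degree) :=
  IsDiffOpLE.apply_mem_pow_sub P j (isDiffOpLE_of_hasseSystem K h0 hmul β.degree β le_rfl hβ) hx

include h0 hmul hext hz in
/-- One monomial, truncated form of res-L1-s31-pv-1's `leibnizFamily_apply_mul_aeval_monomial_sub_mem`: for `|β| ≤ N`,
`|γ| = d ≥ |β|`, `c ∈ O`: `Δ_β(c · φ(X^γ)) − c · φ(D^{(β)} X^γ) ∈ P^{d+1−|β|}`. [folklore] -/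
theorem truncHasse_apply_mul_aeval_monomial_sub_mem {d : ℕ} {γ β : Fin n →₀ ℕ} (hγ : γ.degree = d)
    (hβd : β.degree ≤ d) (hβN : β.degree ≤ N) (c : O) :
    Δ β (c * φ (monomial γ 1)) - c * φ (hasseDeriv K β (monomial γ 1)) ∈ P ^ (d + 1 - β.degree) := by
  have hmem : ((0 : Fin n →₀ ℕ), β) ∈ antidiagonal β := by simp
  rw [hmul β hβN, ← Finset.add_sum_erase _ _ hmem]
  simp only [h0]
  rw [hext β hβN, add_sub_cancel_left]
  refine Ideal.sum_mem _ fun q hq => ?_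
  have hlt : q.2.degree < β.degree := degree_snd_lt_of_mem_erase_antidiagonal hq
  rw [hext q.2 (by omega)]
  have hD : φ (hasseDeriv K q.2 (monomial γ 1)) ∈ P ^ (γ - q.2).degree := by
    rw [hasseDeriv_monomial, map_mul]
    exact Ideal.mul_mem_left _ _ (aeval_monomial_mem_pow_degree φ P hz (γ - q.2) 1)
  have hle : d + 1 - β.degree ≤ (γ - q.2).degree := by
    have := degree_sub_degree_le_degree_tsub γ q.2
    omega
  exact Ideal.mul_mem_left _ _ (Ideal.pow_le_pow_right hle hD)

include h0 hmul hext hz in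
/-- **The symbol congruence, truncated form** (res-L1-s31-pv-1's `leibnizFamily_symbol_congr` for a truncated system of
level `N ≥ |β|`): for `g = Σ_{γ ∈ S} c_γ φ(X^γ) + h`, `|γ| = d` on `S`, `h ∈ P^{d+1}`, `|β| ≤ d`:
`Δ_β g − Σ_γ c_γ φ(D^{(β)} X^γ) ∈ P^{d+1−|β|}`. [folklore] -/
theorem truncHasse_symbol_congr {d : ℕ} (S : Finset (Fin n →₀ ℕ)) (hS : ∀ γ ∈ S, γ.degree = d)
    (c : (Fin n →₀ ℕ) → O) {h : O} (hh : h ∈ P ^ (d + 1)) {β : Fin n →₀ ℕ} (hβd : β.degree ≤ d)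
    (hβN : β.degree ≤ N) :
    Δ β ((∑ γ ∈ S, c γ * φ (monomial γ 1)) + h) - ∑ γ ∈ S, c γ * φ (hasseDeriv K β (monomial γ 1)) ∈
      P ^ (d + 1 - β.degree) := by
  have hΔh : Δ β h ∈ P ^ (d + 1 - β.degree) := truncHasse_apply_mem_pow_sub Δ P N h0 hmul hβN (d + 1) hh
  have hsum : Δ β (∑ γ ∈ S, c γ * φ (monomial γ 1)) - ∑ γ ∈ S, c γ * φ (hasseDeriv K β (monomial γ 1)) ∈
      P ^ (d + 1 - β.degree) := by
    rw [map_sum, ← Finset.sum_sub_distrib]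
    exact Ideal.sum_mem _ fun γ hγ =>
      truncHasse_apply_mul_aeval_monomial_sub_mem Δ φ P N h0 hmul hext hz (hS γ hγ) hβd hβN (c γ)
  have e : Δ β ((∑ γ ∈ S, c γ * φ (monomial γ 1)) + h) - ∑ γ ∈ S, c γ * φ (hasseDeriv K β (monomial γ 1)) =
      (Δ β (∑ γ ∈ S, c γ * φ (monomial γ 1)) - ∑ γ ∈ S, c γ * φ (hasseDeriv K β (monomial γ 1))) + Δ β h := by
    rw [map_add]; ring
  rw [e]
  exact Ideal.add_mem _ hsum hΔh

end Truncated

/-! ## Formal smoothness of `K[X] → O`, `X ↦ z`, yields truncated systems extending the Hasse derivatives -/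

section Extend

variable {K : Type u} [Field K] {O : Type u} [CommRing O] [Algebra K O] {n : ℕ} (z : Fin n → O)
  [Algebra (MvPolynomial (Fin n) K) O] [IsScalarTower K (MvPolynomial (Fin n) K) O]
  (hxz : ∀ i, algebraMap (MvPolynomial (Fin n) K) O (X i) = z i)

include hxz in
/-- Under the structure map `X_i ↦ z_i`, `algebraMap = aeval z`. [folklore] -/
theorem algebraMap_eq_aeval_of_algebraMap_X (F : MvPolynomial (Fin n) K) :
    algebraMap (MvPolynomial (Fin n) K) O F = MvPolynomial.aeval z F := by
  have key : algebraMap (MvPolynomial (Fin n) K) O = (MvPolynomial.aeval z).toRingHom := by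
    refine MvPolynomial.ringHom_ext (fun r => ?_) (fun i => ?_)
    · rw [AlgHom.toRingHom_eq_coe, RingHom.coe_coe, MvPolynomial.algHom_C, ← MvPolynomial.algebraMap_eq,
        ← IsScalarTower.algebraMap_apply]
    · rw [AlgHom.toRingHom_eq_coe, RingHom.coe_coe, MvPolynomial.aeval_X, hxz]
  exact RingHom.congr_fun key F

include hxz in
/-- **Truncated Hasse–Schmidt systems extending the Hasse derivatives along `aeval z`** (from the tree's
`exists_hasseSystem_of_formallySmooth_eval`, EGA IV₄ 16.11.2): if `O` is formally smooth over `K[X]` for `X ↦ z`, then for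
every `N` there are `K`-linear `Δ_β` with `Δ_0 = id`, the Leibniz rule for `|β| ≤ N`, and
`Δ_β(F(z)) = (D^{(β)} F)(z)` for `|β| ≤ N` and every `F ∈ K[X]`. [folklore] -/
theorem exists_truncHasse_extending_hasseDeriv [Algebra.FormallySmooth (MvPolynomial (Fin n) K) O] (N : ℕ) :
    ∃ Δ : (Fin n →₀ ℕ) → (O →ₗ[K] O),
      (∀ b, Δ 0 b = b) ∧
      (∀ β : Fin n →₀ ℕ, β.degree ≤ N → ∀ x y : O, Δ β (x * y) = ∑ q ∈ antidiagonal β, Δ q.1 x * Δ q.2 y) ∧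
      (∀ β : Fin n →₀ ℕ, β.degree ≤ N → ∀ F : MvPolynomial (Fin n) K,
        Δ β (MvPolynomial.aeval z F) = MvPolynomial.aeval z (hasseDeriv K β F)) := by
  classical
  obtain ⟨Δ, h0, hmul, hval⟩ := exists_hasseSystem_of_formallySmooth_eval K (B := O) (ι := Fin n) N
  simp only [hxz] at hval
  refine ⟨Δ, h0, hmul, fun β hβ F => ?_⟩
  -- both sides are `K`-linear in `F`; check on monomials
  have hmon : ∀ (γ : Fin n →₀ ℕ) (c : K),
      Δ β (MvPolynomial.aeval z (monomial γ c)) = MvPolynomial.aeval z (hasseDeriv K β (monomial γ c)) := by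
    intro γ c
    have e1 : MvPolynomial.aeval z (monomial γ c) = c • ∏ i, z i ^ γ i := by
      rw [MvPolynomial.aeval_monomial, Finsupp.prod_fintype _ _ (fun i => pow_zero _), Algebra.smul_def]
    have e2 : MvPolynomial.aeval z (hasseDeriv K β (monomial γ c)) =
        c • (((∏ i ∈ β.support, (γ i).choose (β i) : ℕ) : O) * ∏ i, z i ^ (γ - β) i) := by
      rw [hasseDeriv_monomial, map_mul, map_natCast, MvPolynomial.aeval_monomial,
        Finsupp.prod_fintype _ _ (fun i => pow_zero _), Algebra.smul_def]
      ring
    rw [e1, map_smul, hval β γ hβ, e2]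
  conv_lhs => rw [F.as_sum, map_sum, map_sum]
  conv_rhs => rw [F.as_sum, map_sum, map_sum]
  exact Finset.sum_congr rfl fun γ _ => hmon γ (F.coeff γ)

end Extend

/-! ## Hasse–Schmidt stability of `edgeG` from formal smoothness of the coordinate map -/

section Local

variable {K : Type u} [Field K] {O : Type u} [CommRing O] [IsLocalRing O] [Algebra K O] {n : ℕ}
  (z : Fin n → O) (hz : Ideal.span (Set.range z) = maximalIdeal O)
  (A : ℕ → Ideal O) (h0 : A 0 = ⊤) (hmul : ∀ b c, A b * A c ≤ A (b + c))
  (hdiff : ∀ (d m : ℕ), m < d → ∀ D : O →ₗ[K] O, D ∈ diffOp K O m →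
    ∀ g : O, Polynomial.monomial d g ∈ familySubalgebra O A →
      Polynomial.monomial (d - m) (D g) ∈ familySubalgebra O A)
  [Algebra (MvPolynomial (Fin n) K) O] [IsScalarTower K (MvPolynomial (Fin n) K) O]
  (hxz : ∀ i, algebraMap (MvPolynomial (Fin n) K) O (X i) = z i)

include hz h0 hmul hdiff hxz in
/-- **Homogeneous case** (as `hasseDeriv_mem_of_isHomogeneous_of_leibnizFamily`, p480433, with a TRUNCATED system of
level `|β|` supplied by formal smoothness). [folklore] -/
theorem hasseDeriv_mem_of_isHomogeneous_of_formallySmooth [Algebra.FormallySmooth (MvPolynomial (Fin n) K) O]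
    {U : Subalgebra (ResidueField O) (MvPolynomial (Fin n) (ResidueField O))}
    (hU : (U : Set _) = edgeG (familySubalgebra O A) z hz) {F : MvPolynomial (Fin n) (ResidueField O)} {d : ℕ}
    (hFU : F ∈ U) (hFd : F.IsHomogeneous d) (β : Fin n →₀ ℕ) :
    hasseDeriv (ResidueField O) β F ∈ U := by
  classical
  by_cases hmd : β.degree < d
  swap
  · have h0deg : (hasseDeriv (ResidueField O) β F).IsHomogeneous 0 := by
      have h := isHomogeneous_hasseDeriv hFd β
      rwa [Nat.sub_eq_zero_of_le (not_lt.1 hmd)] at h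
    rw [eq_C_of_isHomogeneous_zero h0deg, ← MvPolynomial.algebraMap_eq]
    exact Subalgebra.algebraMap_mem U _
  -- a truncated system of level `m = |β|`
  set m := β.degree with hm
  obtain ⟨Δ, hΔ0, hΔmul, hΔext⟩ := exists_truncHasse_extending_hasseDeriv z hxz m
  have hFedge : F ∈ edgeG (familySubalgebra O A) z hz := by rw [← hU]; exact hFU
  obtain ⟨G, hG, hGF⟩ := EdgeCone.exists_lift_isHomogeneous F hFd
  have hx : MvPolynomial.eval z G ∈ maximalIdeal O ^ d := EdgeCone.eval_mem_pow_of_isHomogeneous z hz hG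
  have hin : nu O (blMonomial d _ hx) ∈ edgeAlgebra (familySubalgebra O A) := by
    rw [← EdgeCone.blSubst_eq_blMonomial z hz hG hx, ← EdgeCone.polyMap_map_residue, hGF]
    exact hFedge
  obtain ⟨y, ⟨hyA, hym⟩, w, hw, hyw⟩ := Submodule.mem_sup.1 ((nu_blMonomial_mem_edgeAlgebra_iff A h0 hmul d hx).1 hin)
  have hyP : Polynomial.monomial d y ∈ familySubalgebra O A :=
    (S04CharAlgebra.monomial_mem_familySubalgebra_iff A h0 hmul d y).2 hyA
  have hD : Δ β ∈ diffOp K O m := isDiffOpLE_of_hasseSystem K hΔ0 hΔmul m β le_rfl le_rfl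
  have h1 : Δ β y ∈ A (d - m) :=
    (S04CharAlgebra.monomial_mem_familySubalgebra_iff A h0 hmul (d - m) (Δ β y)).1 (hdiff d m hmd (Δ β) hD y hyP)
  have h2 : Δ β y ∈ maximalIdeal O ^ (d - m) :=
    truncHasse_apply_mem_pow_sub Δ (maximalIdeal O) m hΔ0 hΔmul le_rfl d hym
  have hzP : ∀ i, MvPolynomial.aeval z (X i : MvPolynomial (Fin n) K) ∈ maximalIdeal O := fun i => by
    rw [MvPolynomial.aeval_X, ← hz]; exact Ideal.subset_span ⟨i, rfl⟩
  have hyshape : y = (∑ γ ∈ G.support, G.coeff γ * MvPolynomial.aeval z (monomial γ (1 : K))) + (-w) := by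
    rw [← eval_eq_sum_mul_aeval_monomial (K := K) z G, ← hyw]; ring
  have hcongr := truncHasse_symbol_congr Δ (MvPolynomial.aeval z) (maximalIdeal O) m hΔ0 hΔmul hΔext hzP
    G.support (fun γ hγ => degree_eq_of_mem_support hG hγ) (fun γ => G.coeff γ) (neg_mem hw) hmd.le le_rfl
  rw [← hyshape, ← eval_hasseDeriv_eq_sum (K := K) z β G] at hcongr
  have hG₂ : (hasseDeriv O β G).IsHomogeneous (d - m) := isHomogeneous_hasseDeriv hG β
  have hG₂F : MvPolynomial.map (residue O) (hasseDeriv O β G) = hasseDeriv (ResidueField O) β F := by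
    rw [map_hasseDeriv, hGF]
  have hx₂ : MvPolynomial.eval z (hasseDeriv O β G) ∈ maximalIdeal O ^ (d - m) :=
    EdgeCone.eval_mem_pow_of_isHomogeneous z hz hG₂
  have hsub : Δ β y - MvPolynomial.eval z (hasseDeriv O β G) ∈ maximalIdeal O ^ (d - m + 1) := by
    have e : d + 1 - m = d - m + 1 := by omega
    rw [← e]
    exact hcongr
  have hin₂ : nu O (blMonomial (d - m) _ hx₂) ∈ edgeAlgebra (familySubalgebra O A) := by
    rw [← EdgeCone.nu_blMonomial_eq_of_sub_mem h2 hx₂ hsub]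
    exact (nu_blMonomial_mem_edgeAlgebra_iff A h0 hmul (d - m) h2).2 (Submodule.mem_sup_left ⟨h1, h2⟩)
  rw [← SetLike.mem_coe, hU, edgeG, Set.mem_preimage, ← hG₂F, EdgeCone.polyMap_map_residue,
    EdgeCone.blSubst_eq_blMonomial z hz hG₂ hx₂]
  exact hin₂

include h0 hmul hdiff hxz in
/-- **[OURS · L1 W3.1] Hasse–Schmidt stability of the pulled-back edge algebra from formal smoothness of the coordinate
map** (local form): `(O, 𝔪, κ)` a local `K`-algebra, `z` generating `𝔪`, `O` FORMALLY SMOOTH over `K[X_1,…,X_n]` for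
`X_i ↦ z_i`, `A` a graded family whose algebra `⊕ A_d X^d` is Diff-closed in the shape of the typed `U19_3`; then
`edgeG (⊕ A_d X^d) z ⊆ κ[Z]` is stable under every Hasse–Schmidt derivation of `κ[Z]`. NOT a statement of the manuscript.
[folklore] -/
theorem hasseDeriv_mem_edgeG_of_formallySmooth [Algebra.FormallySmooth (MvPolynomial (Fin n) K) O]
    (β : Fin n →₀ ℕ) {F : MvPolynomial (Fin n) (ResidueField O)} (hF : F ∈ edgeG (familySubalgebra O A) z hz) :
    hasseDeriv (ResidueField O) β F ∈ edgeG (familySubalgebra O A) z hz := by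
  classical
  obtain ⟨U, hU⟩ := exists_subalgebra_coe_eq_edgeG z hz (familySubalgebra O A)
  have hUg : IsGradedSubalgebra U := isGradedSubalgebra_of_coe_eq_edgeG z hz A h0 hmul hU
  have hFU : F ∈ U := by rw [← SetLike.mem_coe, hU]; exact hF
  rw [← hU, SetLike.mem_coe, ← MvPolynomial.sum_homogeneousComponent F, map_sum]
  exact Subalgebra.sum_mem U fun e _ =>
    hasseDeriv_mem_of_isHomogeneous_of_formallySmooth z hz A h0 hmul hdiff hxz hU (hUg F hFU e)
      (MvPolynomial.homogeneousComponent_isHomogeneous e F) β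

end Local

end CampaignW31

open CampaignW31

/-! ## Scheme level -/

section Sheaf

variable {K : Type u} [Field K] {Z : Scheme.{u}}

/-- **[OURS · L1 W3.1] `U19_4_R2` from `U19_3` and FORMAL SMOOTHNESS OF THE COORDINATE MAPS** (steps (2)+(4) of the W3.1
route, the Leibniz families being supplied by the tree's truncated Hasse–Schmidt systems, EGA IV₄ 16.11.2): if `℘(E)_ξ` is
Diff-closed stalkwise (typed `U19_3`, HYPOTHESIS) and, at every closed `ξ ∈ Sing(E)`, every regular system of parameters
`z` makes `O_{Z,ξ}` formally smooth over `K[X_1,…,X_n]` via `X ↦ z` (HYPOTHESIS — standard for the local ring of a smooth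
`K`-scheme at a closed point with separable residue field), then `edgeG (℘(E)_ξ) z` is Hasse–Schmidt stable (`U19_4_R2`).
NOT a statement of the manuscript. [folklore] -/
theorem U19_4_R2_of_U19_3_of_formallySmooth (p : ℕ) [Fact p.Prime] [CharP K p] (f : Z ⟶ Spec (.of K))
    (E : IdealExponent Z) (h3 : U19_3 p f E)
    (hsm : ∀ ξ ∈ E.sing, ξ ∈ S02Preliminaries.closedPoints Z → ∀ (n : ℕ) (z : Fin n → Z.presheaf.stalk ξ),
      IsRSP (Z.presheaf.stalk ξ) z →
        letI := stalkAlgebra (kStructure f) ξ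
        letI := (MvPolynomial.aeval (R := K) z).toRingHom.toAlgebra
        Algebra.FormallySmooth (MvPolynomial (Fin n) K) (Z.presheaf.stalk ξ)) :
    U19_4_R2 p f E := by
  intro hA hK hE ξ hξ hcl n z hz β F hF
  letI := stalkAlgebra (kStructure f) ξ
  letI alg : Algebra (MvPolynomial (Fin n) K) (Z.presheaf.stalk ξ) := (MvPolynomial.aeval (R := K) z).toRingHom.toAlgebra
  have hxz : ∀ i, algebraMap (MvPolynomial (Fin n) K) (Z.presheaf.stalk ξ) (X i) = z i :=
    fun i => MvPolynomial.aeval_X z i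
  haveI : IsScalarTower K (MvPolynomial (Fin n) K) (Z.presheaf.stalk ξ) :=
    IsScalarTower.of_algebraMap_eq fun r => by
      change algebraMap K _ r = MvPolynomial.aeval z (algebraMap K (MvPolynomial (Fin n) K) r)
      rw [MvPolynomial.algebraMap_eq, MvPolynomial.aeval_C]
  haveI : Algebra.FormallySmooth (MvPolynomial (Fin n) K) (Z.presheaf.stalk ξ) := hsm ξ hξ hcl n z hz
  haveI := hA.smooth
  haveI : IsLocallyNoetherian Z := LocallyOfFiniteType.isLocallyNoetherian f
  have hR : Scheme.IsRegular Z := Scheme.IsRegular.of_smooth f (Scheme.isRegular_Spec (.of K))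
  have hdiff := h3 hA hK hE ξ hξ hcl
  exact hasseDeriv_mem_edgeG_of_formallySmooth z hz.2.1 (fun d => stalkIdeal (pAlg E d) ξ) (stalkIdeal_pAlg_zero E ξ)
    (stalkIdeal_pAlg_mul_le hR E ξ) hdiff hxz β hF

/-- **[OURS · L1 W3.1] THE SLOT STATEMENT modulo Th. 4.1 and formal smoothness of the coordinate maps**: with
`Thm4_1` (typed candidate, HYPOTHESIS; through the HIRONAKA-L lane's `U19_3_of`) and the formal smoothness of
`K[X] → O_{Z,ξ}`, `X ↦ z`, for every r.s.p. at every closed singular point, `ξ ↦ Inv_ξ(E)` is upper semicontinuous on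
`Sing(E)_cl` for every standard `E` and every selection of Def. 4.9 edge data (`CampaignW31UscInvOneExponentI p`, via
p479154). NOT a statement of the manuscript. [folklore] -/
theorem campaignW31UscInvOneExponentI_of_Thm4_1_of_formallySmooth (p : ℕ) [Fact p.Prime]
    (h41 : ∀ (K : Type u) [Field K] [CharP K p] [PerfectField K] (A : AmbientDatum p K) (E : IdealExponent A.Z),
      Thm4_1 p A.hom E)
    (hsm : ∀ (K : Type u) [Field K] [CharP K p] [PerfectField K] (A : AmbientDatum p K) (E : IdealExponent A.Z),
      ∀ ξ ∈ E.sing, ξ ∈ S02Preliminaries.closedPoints A.Z → ∀ (n : ℕ) (z : Fin n → A.Z.presheaf.stalk ξ),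
        IsRSP (A.Z.presheaf.stalk ξ) z →
          letI := stalkAlgebra (kStructure A.hom) ξ
          letI := (MvPolynomial.aeval (R := K) z).toRingHom.toAlgebra
          Algebra.FormallySmooth (MvPolynomial (Fin n) K) (A.Z.presheaf.stalk ξ)) :
    CampaignW31UscInvOneExponentI.{u} p :=
  campaignW31UscInvOneExponentI_of_U19_4_R2 p fun K _ _ _ A E =>
    U19_4_R2_of_U19_3_of_formallySmooth p A.hom E (U19_3_of p A.hom E (h41 K A E)) (hsm K A E)

end Sheaf

end Summit.ResolutionOfSingularities.ResolutionOfSingularities.Theorems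

end
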